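import Mathlib
import Summits.Ventures.PercRepro2.HalfLA12

/-!
# (HCOV) for every `a₃` of degree two whose neighbours are marks (blind cell PercRepro2, night-1 g37)

`HCov_degTwoMarks`: if the only edges at `a₃` are `e₁ = {x, a₃}` and `e₂ = {y, a₃}` with `x ≠ y` both in
`{o, b, a₁, a₂}`, then (HCOV) holds — the six classes `{o, b}` (`HalfLTwoMark.HCov_twoMark`), `{a₂, b}`,
`{a₁, b}` (`HalfLA1B.HCov_a2b` / `HCov_a1b`), `{a₂, o}`, `{a₁, o}` (`HalfLA1O.HCov_a2o` / `HCov_a1o`) and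
`{a₁, a₂}` (`HalfLA12.HCov_a12`), each for every weight of the two edges and every base graph.  With the
pendant theorems (a₃ of degree one at a mark) this is the whole table «`a₃` of degree ≤ 2 touching only marks».
-/

namespace Summit.Ventures.PercRepro2

namespace HalfLTwoMark

open CaseOne CovForm

section Main

variable {V : Type*} {E : Type*} [Fintype E] [DecidableEq E] [Fintype V] [DecidableEq V]
  {R : Type*} [Field R] [LinearOrder R] [IsStrictOrderedRing R]

/-- **(HCOV) for `a₃` of degree two with both neighbours among the marks `o, b, a₁, a₂`.** -/
theorem HCov_degTwoMarks (p : E → R) (hp : IsProbVec p) (ends : E → Sym2 V) (o a₁ a₂ a₃ b : V)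
    (e₁ e₂ : E) (x y : V) (hx : x ∈ ({o, b, a₁, a₂} : Finset V)) (hy : y ∈ ({o, b, a₁, a₂} : Finset V))
    (hxy : x ≠ y) (h1 : ends e₁ = s(x, a₃)) (h2 : ends e₂ = s(y, a₃)) (hne : e₁ ≠ e₂)
    (hu : ∀ e, a₃ ∈ ends e → e = e₁ ∨ e = e₂) (ho3 : o ≠ a₃) (hb3 : b ≠ a₃) (h13 : a₁ ≠ a₃)
    (h23 : a₂ ≠ a₃) : HCov p ends o a₁ a₂ a₃ b := by
  simp only [Finset.mem_insert, Finset.mem_singleton] at hx hy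
  rcases hx with rfl | rfl | rfl | rfl <;> rcases hy with rfl | rfl | rfl | rfl
  · exact absurd rfl hxy
  · exact HalfLTwoMark.HCov_twoMark p hp ⟨h1, h2, hne, hu, ho3, hb3⟩ h13 h23
  · exact HalfLA1O.HCov_a1o p hp ⟨h2, h1, hne.symm, fun e he => (hu e he).symm, h13, ho3⟩ h23 hb3
  · exact HalfLA1O.HCov_a2o p hp ⟨h2, h1, hne.symm, fun e he => (hu e he).symm, h23, ho3⟩ h13 hb3
  · exact HalfLTwoMark.HCov_twoMark p hp ⟨h2, h1, hne.symm, fun e he => (hu e he).symm, ho3, hb3⟩ h13 h23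
  · exact absurd rfl hxy
  · exact HalfLA1B.HCov_a1b p hp ⟨h2, h1, hne.symm, fun e he => (hu e he).symm, h13, hb3⟩ h23 ho3
  · exact HalfLA1B.HCov_a2b p hp ⟨h2, h1, hne.symm, fun e he => (hu e he).symm, h23, hb3⟩ h13 ho3
  · exact HalfLA1O.HCov_a1o p hp ⟨h1, h2, hne, hu, h13, ho3⟩ h23 hb3
  · exact HalfLA1B.HCov_a1b p hp ⟨h1, h2, hne, hu, h13, hb3⟩ h23 ho3
  · exact absurd rfl hxy
  · exact HalfLA12.HCov_a12 p hp ⟨h1, h2, hne, hu, h13, h23⟩ ho3 hb3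
  · exact HalfLA1O.HCov_a2o p hp ⟨h1, h2, hne, hu, h23, ho3⟩ h13 hb3
  · exact HalfLA1B.HCov_a2b p hp ⟨h1, h2, hne, hu, h23, hb3⟩ h13 ho3
  · exact HalfLA12.HCov_a12 p hp ⟨h2, h1, hne.symm, fun e he => (hu e he).symm, h13, h23⟩ ho3 hb3
  · exact absurd rfl hxy

end Main

end HalfLTwoMark

end Summit.Ventures.PercRepro2
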